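import Summits.Parity.GeneralizedHardyLittlewood.Theorems.FordMaynardSieveConst01651SieveConst01651BuchstabForm
import Summits.Parity.GeneralizedHardyLittlewood.Theorems.FordMaynardSieveConst01651SieveConst01651CertReduction
import HarnessLib

/-!
# Route `FordMaynardSieveConst01651`, target `SieveConst01651` (stmt-Parity-19185), stub `stub_certValuePos` (R2):
# cuts of the Buchstab form — support `t ≤ 1/2`, the `r = 1` pairing in closed form, `Φ₆(1) = 1 + Ψ(1 − ν₀)`

Def-free helper file continuing `…BuchstabForm.sieveBoundG1_coneCert_eq_buchstab`.  With `ν₀ = 0.1651`,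
`φ = 𝟙[· > ν₀]/·`, `Φ₆ = Σ_{m ≤ 6} φ^{⋆m}/m!`, `Ψ(y) = ∫_{(0,y]} Φ₆`, `S⁰_r` the ordered slice functions of `coneCert`:

* `phiSix_one_eq` — `Φ₆(1) = 1 + Ψ(1 − ν₀)` (Volterra at `x = 1`);
* `pairing_eq_half` — `∫_{(0,1]} S⁰_r Φ₆(1−·) = ∫_{(0,1/2]} S⁰_r Φ₆(1−·)` (`S⁰_r(t) = 0` for `t > 1/2` by the closed
  support clause `coneCert_support`), so `Φ₆` is only needed on `[1/2, 1)`;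
* `sliceFnOrd_one_coneCert` — off the finite edge set, `S⁰_1(t) = −𝟙[ν₀ < t ≤ 1/2]/t`; `edgeSet_finite`;
* `pairing_one_eq` — **`∫_{(0,1]} S⁰_1(t) Φ₆(1−t) dt = −∫_{(ν₀,1/2]} Φ₆(1−t)/t dt`**;
* `sieveBoundG1_coneCert_eq_cut` — the assembled form
  `V = 1 + Ψ(1−ν₀) − ∫_{(ν₀,1/2]} Φ₆(1−t)/t dt + ∫_{(0,1/2]} S⁰_2 Φ₆(1−·) + ∫_{(0,1/2]} S⁰_3 Φ₆(1−·)`.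

References: [FordMaynard2024PrimeSieves] arXiv:2407.14368, Theorem 7.3 (a), §8.2.
-/

noncomputable section

open MeasureTheory Set Finset
open scoped Classical
open Literature.NumberTheory.Sieve Literature.NumberTheory.Sieve.FordMaynard
open Literature.Analysis.Convolution

namespace Summit.Parity.GeneralizedHardyLittlewood.FordMaynardSieveConst01651SieveConst01651

/-- **`Φ₆(1) = 1 + Ψ(1 − ν₀)`**: Buchstab's Volterra equation at `x = 1 < 7ν₀`. [folklore] -/
theorem phiSix_one_eq :
    ∑ m ∈ Finset.Icc 1 6, (1 / (m.factorial : ℝ)) *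
        cpow (fun t : ℝ => if (1651 / 10000 : ℝ) < t then 1 / t else 0) m 1 =
      1 + ∫ t in Set.Ioc 0 (1 - 1651 / 10000 : ℝ), ∑ m ∈ Finset.Icc 1 6, (1 / (m.factorial : ℝ)) *
        cpow (fun t : ℝ => if (1651 / 10000 : ℝ) < t then 1 / t else 0) m t := by
  have h := buchstab_volterra_six (ν := (1651 / 10000 : ℝ)) (by norm_num) (x := 1) (by norm_num)
  rw [one_mul, if_pos (by norm_num : (1651 / 10000 : ℝ) < 1)] at h
  exact h

/-- **Support cut**: for `r ≥ 1` the pairing lives on `t ≤ 1/2` (`S⁰_r(t) = 0` for `t > 1/2`, closed support of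
`coneCert`). [cite: FordMaynard2024PrimeSieves, (7.1) (𝒢₁: |x| ≤ 1/2)] -/
theorem pairing_eq_half {r : ℕ} (hr : 1 ≤ r) (F : ℝ → ℝ) :
    ∫ t in Set.Ioc 0 1, sliceIntegral r t
        (fun v => if (∀ i, (1651 / 10000 : ℝ) < v i) ∧ Monotone v then coneCert r v / ∏ i, v i else 0) * F t =
      ∫ t in Set.Ioc 0 (1 / 2), sliceIntegral r t
        (fun v => if (∀ i, (1651 / 10000 : ℝ) < v i) ∧ Monotone v then coneCert r v / ∏ i, v i else 0) * F t := by
  refine setIntegral_eq_of_subset_of_forall_sdiff_eq_zero measurableSet_Ioc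
    (Set.Ioc_subset_Ioc_right (by norm_num)) fun t ht => ?_
  have ht' : 1 / 2 < t := by
    rcases ht with ⟨⟨h0, h1⟩, hn⟩
    by_contra hle
    exact hn ⟨h0, not_lt.1 hle⟩
  rw [sliceFnOrd_eq_zero_of_half_lt (fun k x hx hne => coneCert_support k x hx hne) hr ht', zero_mul]

/-- The grid-edge set is finite. [folklore] -/
theorem edgeSet_finite : edgeSet.Finite := by
  have h : edgeSet ⊆ (fun a : ℕ => ((certEdge a : ℚ) : ℝ)) '' (Set.Iic 85) := by
    rintro t ⟨a, ha, rfl⟩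
    exact ⟨a, ha, rfl⟩
  exact (Set.finite_Iic 85).image _ |>.subset h

/-- **`S⁰_1(t) = −𝟙[ν₀ < t ≤ 1/2]/t` off the edge set** (`g₀,₁ = −1` on the small cells, `0` beyond `1/2`, face values
only on `edgeSet`). [cite: FordMaynard2024PrimeSieves, §8.2 (g₁ ≡ −1)] -/
theorem sliceFnOrd_one_coneCert {t : ℝ} (he : t ∉ edgeSet) :
    sliceIntegral 1 t
        (fun v => if (∀ i, (1651 / 10000 : ℝ) < v i) ∧ Monotone v then coneCert 1 v / ∏ i, v i else 0) =
      if (1651 / 10000 : ℝ) < t ∧ t ≤ 1 / 2 then -(1 / t) else 0 := by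
  rw [sliceFnOrd_one (by norm_num : (0 : ℝ) < 1651 / 10000) coneCert t]
  by_cases h1 : (1651 / 10000 : ℝ) < t
  · rw [if_pos h1]
    by_cases h2 : t ≤ 1 / 2
    · rw [if_pos ⟨h1, h2⟩, coneCert_one_eq (fun _ => t) h1 h2 he]
      ring
    · rw [if_neg (fun h => h2 h.2), coneCert_one_eq_zero_of_half_lt (fun _ => t) (not_le.1 h2), zero_div]
  · rw [if_neg h1, if_neg (fun h => h1 h.1)]

/-- **The `r = 1` pairing in closed form**: `∫_{(0,1]} S⁰_1(t) F(t) dt = −∫_{(ν₀,1/2]} F(t)/t dt` for any `F`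
(the edge set is null). [cite: FordMaynard2024PrimeSieves, §8.2] -/
theorem pairing_one_eq (F : ℝ → ℝ) :
    ∫ t in Set.Ioc 0 1, sliceIntegral 1 t
        (fun v => if (∀ i, (1651 / 10000 : ℝ) < v i) ∧ Monotone v then coneCert 1 v / ∏ i, v i else 0) * F t =
      -∫ t in Set.Ioc (1651 / 10000 : ℝ) (1 / 2), F t / t := by
  have hae : ∀ᵐ t ∂(volume.restrict (Set.Ioc (0 : ℝ) 1)), sliceIntegral 1 t
      (fun v => if (∀ i, (1651 / 10000 : ℝ) < v i) ∧ Monotone v then coneCert 1 v / ∏ i, v i else 0) * F t =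
      (Set.Ioc (1651 / 10000 : ℝ) (1 / 2)).indicator (fun t => -(F t / t)) t := by
    filter_upwards [ae_restrict_of_ae (edgeSet_finite.countable.ae_notMem (volume : Measure ℝ))] with t ht
    rw [sliceFnOrd_one_coneCert ht]
    simp only [Set.indicator, Set.mem_Ioc]
    split_ifs <;> ring
  rw [integral_congr_ae hae, integral_indicator measurableSet_Ioc, Measure.restrict_restrict measurableSet_Ioc,
    show Set.Ioc (1651 / 10000 : ℝ) (1 / 2) ∩ Set.Ioc 0 1 = Set.Ioc (1651 / 10000 : ℝ) (1 / 2) from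
      Set.inter_eq_left.2 (Set.Ioc_subset_Ioc (by norm_num) (by norm_num)),
    integral_neg]

/-- **The certificate value, cut form.**  `V(ν₀, coneCert) = 1 + Ψ(1 − ν₀) − ∫_{(ν₀,1/2]} Φ₆(1−t)/t dt
+ ∫_{(0,1/2]} S⁰_2(t) Φ₆(1−t) dt + ∫_{(0,1/2]} S⁰_3(t) Φ₆(1−t) dt`: everything is `Φ₆` on `[1/2, 1)` (one
Volterra table) against the `−1/t` weight, the `g₂` cells and the `g₃` cells.
[cite: FordMaynard2024PrimeSieves, Theorem 7.3 (a), §8.2] -/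
theorem sieveBoundG1_coneCert_eq_cut :
    sieveBoundG1 (1651 / 10000) coneCert =
      1 + (∫ t in Set.Ioc 0 (1 - 1651 / 10000 : ℝ), ∑ m ∈ Finset.Icc 1 6, (1 / (m.factorial : ℝ)) *
            cpow (fun t : ℝ => if (1651 / 10000 : ℝ) < t then 1 / t else 0) m t)
        - (∫ t in Set.Ioc (1651 / 10000 : ℝ) (1 / 2), (∑ m ∈ Finset.Icc 1 6, (1 / (m.factorial : ℝ)) *
            cpow (fun t : ℝ => if (1651 / 10000 : ℝ) < t then 1 / t else 0) m (1 - t)) / t)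
        + (∫ t in Set.Ioc 0 (1 / 2), sliceIntegral 2 t
            (fun v => if (∀ i, (1651 / 10000 : ℝ) < v i) ∧ Monotone v then coneCert 2 v / ∏ i, v i else 0) *
            ∑ m ∈ Finset.Icc 1 6, (1 / (m.factorial : ℝ)) *
              cpow (fun t : ℝ => if (1651 / 10000 : ℝ) < t then 1 / t else 0) m (1 - t))
        + (∫ t in Set.Ioc 0 (1 / 2), sliceIntegral 3 t
            (fun v => if (∀ i, (1651 / 10000 : ℝ) < v i) ∧ Monotone v then coneCert 3 v / ∏ i, v i else 0) *
            ∑ m ∈ Finset.Icc 1 6, (1 / (m.factorial : ℝ)) *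
              cpow (fun t : ℝ => if (1651 / 10000 : ℝ) < t then 1 / t else 0) m (1 - t)) := by
  rw [sieveBoundG1_coneCert_eq_buchstab, phiSix_one_eq]
  have h3 : Finset.Icc 1 3 = {1, 2, 3} := by decide
  rw [h3, Finset.sum_insert (by decide), Finset.sum_insert (by decide), Finset.sum_singleton,
    pairing_one_eq, pairing_eq_half (by norm_num : 1 ≤ 2), pairing_eq_half (by norm_num : 1 ≤ 3)]
  ring

end Summit.Parity.GeneralizedHardyLittlewood.FordMaynardSieveConst01651SieveConst01651

end
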